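import Mathlib
import HarnessLib
import Literature.Analysis.FluidPDE.ClassicalSolution
import Literature.Analysis.FluidPDE.ClassicalSolutionGlue
import Literature.Analysis.FluidPDE.NSLerayStrongLocalExistence
import Literature.Analysis.FluidPDE.NSBoundedMildSmoothing
import Literature.Analysis.FluidPDE.NSBoundedMildOseenClassical
import Literature.Analysis.FluidPDE.PressureReconstruction
import Literature.Analysis.FluidPDE.KNSSMildRegularity
import Literature.Analysis.FluidPDE.KNSSRegularityGluing
import Literature.Analysis.FluidPDE.KNSSOseenMildDecayOfLemma31
import Literature.Analysis.FluidPDE.KNSSWeakDriftMildProofs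
import Summits.NavierStokesRegularity.NavierStokesRegularity.Theorems.TypeICertificateLadderTargetRssCompactnessPressureCover
import Summits.NavierStokesRegularity.NavierStokesRegularity.Theorems.LocalSineTubeDoorProfileAlignedWindowRigidityAncient

/-!
# ZoomReturnDoorClassicalLimit — S25 «ZoomReturnDoor», the engine E2: a continuous, Type-I-decaying
# bounded weak ancient field is CLASSICAL (nsreg-p1 ROUND-24 ADDENDUM-24C, stub `stub_classical_limit`)

The one open stub of the planner's kit part 7/7 (`ZoomReturnDoorSkeleton.lean`, nsreg-p1 g20), proved: a field
`v` which is jointly continuous, a bounded weak Navier–Stokes solution (`ν = 1`) below `−1/4`, and obeys the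
Type-I decay `‖v(t,y)‖ ≤ D/(‖y‖ + √(−t))` for `t ≤ −1/4`, is a classical solution below `−1/4` for some
pressure.  Tree path: (ii) OSEEN-MILD on every window (KNSS 2009 Thm 6.1 mildness clause in bounded weak form,
`oseenMild_of_cylRadius_decay_window_of_boundedWeak` with Lemma 3.1 `KNSS2009_weak_driftMild_holds`; the decay
kills the parasitic drift); (iii) joint real-analyticity on the open slab (`analyticOnNhd_uncurry`), hence
smoothness; (iv) on each window `(−(k+1), 0)` (shifted to `(0, k+1)`): `isDivFree_of_ae_isWeaklyDivFree_of_smooth`,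
`integral_inner_momentum_eq_zero_of_slab_weak`, `exists_isClassicalNSSolutionOn_of_forall_integral_inner_eq_zero`
(Steps 3–4 of `ChaeWolf.limit_eq_zero`); (v) ONE pressure on the half-line by `rssCompact_exists_pressure_of_cover`.
Consumers: K-band `BandStability` and K-open `RemovableSetOpen` (part 1 `ZoomReturnDoorDefs`), via the skeleton.
WHAT THIS IS NOT: not NS regularity; a regularity statement for decaying bounded weak ancient solutions.
-/

noncomputable section

set_option linter.dupNamespace false

namespace Summit.NavierStokesRegularity.NavierStokesRegularity.Theorems.ZoomReturnDoorClassicalLimit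

open MeasureTheory Set Function Filter Topology Metric
open scoped ENNReal NNReal Topology RealInnerProductSpace
open Literature.Analysis Literature.Analysis.FluidPDE

/-- A continuous field which is a bounded weak solution on the half-line `(−∞, 0)`, jointly SMOOTH on the open
slab, is a classical solution on every window `(−T, 0)` for some pressure (Steps 3–4 of
`ChaeWolf.limit_eq_zero` on the window shifted to `(0, T)`: `isDivFree_of_ae_isWeaklyDivFree_of_smooth`,
`integral_inner_momentum_eq_zero_of_slab_weak`, `exists_isClassicalNSSolutionOn_of_forall_integral_inner_eq_zero`,
then `comp_add_right` back). -/
theorem exists_pressure_window {V : ℝ → EuclideanSpace ℝ (Fin 3) → EuclideanSpace ℝ (Fin 3)}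
    (hsm : IsSmoothSpaceTimeOn (Iio 0) V) (hbw : IsBoundedWeakNSSolutionOn (Iio 0) isOpen_Iio 1 V)
    (T : ℝ) :
    ∃ q : ℝ → EuclideanSpace ℝ (Fin 3) → ℝ, IsClassicalNSSolutionOn (Ioo (-T) 0) 1 0 V q := by
  -- the shifted window `W σ = V (σ − T)` on `(0, T)`
  set W : ℝ → EuclideanSpace ℝ (Fin 3) → EuclideanSpace ℝ (Fin 3) := fun σ => V (σ + -T) with hW
  have hWsm : IsSmoothSpaceTimeOn (Ioo 0 T) W := by
    have h1 := hsm.comp_add_right (-T)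
    refine h1.mono fun σ hσ => ?_
    simp only [mem_preimage, mem_Iio]
    linarith [hσ.2]
  have hWweak : IsBoundedWeakNSSolutionOn (Ioo 0 T) isOpen_Ioo 1 W :=
    (hbw.mono (J := Ioo (-T) 0) isOpen_Ioo Ioo_subset_Iio_self).comp_add_right (-T) (J := Ioo 0 T)
      isOpen_Ioo fun τ => by
        simp only [mem_Ioo]
        constructor <;> intro h <;> constructor <;> linarith [h.1, h.2]
  have hWdiv : ∀ τ ∈ Ioo (0 : ℝ) T, VectorCalculus.IsDivFree (W τ) := fun τ hτ =>
    isDivFree_of_ae_isWeaklyDivFree_of_smooth hWsm hWweak.ae_isWeaklyDivFree hτ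
  have horth := fun {τ : ℝ} (hτ : τ ∈ Ioo (0 : ℝ) T)
      {φ : EuclideanSpace ℝ (Fin 3) → EuclideanSpace ℝ (Fin 3)}
      (hφ : FunctionSpaces.IsTestFunctionOn
        (⊤ : TopologicalSpace.Opens (EuclideanSpace ℝ (Fin 3))) φ)
      (hφd : VectorCalculus.IsDivFree φ) =>
    integral_inner_momentum_eq_zero_of_slab_weak hWsm hWdiv hWweak.2.2.2 hτ hφ hφd
  have hf0 : IsSmoothSpaceTimeOn (Ioo 0 T)
      (0 : ℝ → EuclideanSpace ℝ (Fin 3) → EuclideanSpace ℝ (Fin 3)) := contDiffOn_const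
  obtain ⟨P, hcl⟩ := exists_isClassicalNSSolutionOn_of_forall_integral_inner_eq_zero isOpen_Ioo
    hWsm hf0 hWdiv (fun τ hτ φ hφ hφd => horth hτ hφ hφd)
  -- translate back to `(−T, 0)`
  refine ⟨fun t => P (t + T), ?_⟩
  have h1 := hcl.comp_add_right T
  have hS : (fun t : ℝ => t + T) ⁻¹' Ioo 0 T = Ioo (-T) 0 := by
    ext t; simp only [mem_preimage, mem_Ioo]; constructor <;> intro h <;> constructor <;> linarith [h.1, h.2]
  rw [hS] at h1
  refine h1.congr_velocity fun t _ => ?_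
  simp only [hW, add_neg_cancel_right]

/-- **E2 `stub_classical_limit` PROVED — a continuous, Type-I-decaying, bounded-weak field below `−1/4` is
classical there.**  Signature verbatim from the planner's skeleton (nsreg-p1 g20, kit part 7/7).  The decay
hypothesis is essential: without it the parasitic drifts `b(t)` of bounded weak solutions are counterexamples;
here it supplies the horizontal decay `cylRadius(y)‖v‖ ≤ D` that kills the drift in KNSS's Theorem 6.1. -/
theorem classical_limit {D : ℝ} (hD : 0 < D)
    {v : ℝ → EuclideanSpace ℝ (Fin 3) → EuclideanSpace ℝ (Fin 3)} (hvc : Continuous (uncurry v))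
    (hbw : IsBoundedWeakNSSolutionOn (Iio 0) isOpen_Iio 1 (fun t => v (t - 1 / 4)))
    (hdecv : ∀ t ≤ -(1 / 4 : ℝ), ∀ y, ‖v t y‖ ≤ D / (‖y‖ + Real.sqrt (-t))) :
    ∃ q : ℝ → EuclideanSpace ℝ (Fin 3) → ℝ, IsClassicalNSSolutionOn (Iio (-(1 / 4 : ℝ))) 1 0 v q := by
  -- the shifted field `V τ = v (τ − 1/4)` on `(−∞, 0)`
  set V : ℝ → EuclideanSpace ℝ (Fin 3) → EuclideanSpace ℝ (Fin 3) := fun τ => v (τ - 1 / 4) with hV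
  have hVc : Continuous (uncurry V) := by
    have : uncurry V = uncurry v ∘ fun z : ℝ × EuclideanSpace ℝ (Fin 3) => (z.1 - 1 / 4, z.2) := by
      funext z; rfl
    rw [this]
    exact hvc.comp ((continuous_fst.sub continuous_const).prodMk continuous_snd)
  have hcont : ContinuousOn (uncurry V) (Iio (0 : ℝ) ×ˢ univ) := hVc.continuousOn
  -- bounds: `‖V τ y‖ ≤ D/(‖y‖ + √(1/4 − τ)) ≤ 2D` and `cylRadius y ‖V τ y‖ ≤ ‖y‖ ‖V τ y‖ ≤ D` for `τ < 0`
  have hdecV : ∀ τ < (0 : ℝ), ∀ y, ‖V τ y‖ ≤ D / (‖y‖ + Real.sqrt (-(τ - 1 / 4))) := fun τ hτ y =>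
    hdecv (τ - 1 / 4) (by linarith) y
  have hL : ∀ τ < (0 : ℝ), ∀ y, ‖V τ y‖ ≤ 2 * D := by
    intro τ hτ y
    refine (hdecV τ hτ y).trans ?_
    have h12 : (1 / 2 : ℝ) ≤ Real.sqrt (-(τ - 1 / 4)) := (Real.le_sqrt' (by norm_num)).2 (by nlinarith)
    have hden : (1 / 2 : ℝ) ≤ ‖y‖ + Real.sqrt (-(τ - 1 / 4)) := by linarith [norm_nonneg y]
    calc D / (‖y‖ + Real.sqrt (-(τ - 1 / 4))) ≤ D / (1 / 2) :=
          div_le_div_of_nonneg_left hD.le (by norm_num) hden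
      _ = 2 * D := by ring
  have hcyl : ∀ y : EuclideanSpace ℝ (Fin 3), cylRadius y ≤ ‖y‖ := by
    intro y
    rw [cylRadius, EuclideanSpace.norm_eq]
    apply Real.sqrt_le_sqrt
    have h : ∑ i : Fin 3, ‖y i‖ ^ 2 = y 0 ^ 2 + y 1 ^ 2 + y 2 ^ 2 := by
      simp [Fin.sum_univ_three, Real.norm_eq_abs, sq_abs]
    rw [h]
    nlinarith [sq_nonneg (y 2)]
  have hDec : ∀ τ < (0 : ℝ), ∀ y : EuclideanSpace ℝ (Fin 3), cylRadius (y - 0) * ‖V τ y‖ ≤ D := by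
    intro τ hτ y
    rw [sub_zero]
    have hsq : 0 < Real.sqrt (-(τ - 1 / 4)) := Real.sqrt_pos.2 (by linarith)
    have hden : 0 < ‖y‖ + Real.sqrt (-(τ - 1 / 4)) := by positivity
    calc cylRadius y * ‖V τ y‖ ≤ ‖y‖ * ‖V τ y‖ := mul_le_mul_of_nonneg_right (hcyl y) (norm_nonneg _)
      _ ≤ ‖y‖ * (D / (‖y‖ + Real.sqrt (-(τ - 1 / 4)))) := mul_le_mul_of_nonneg_left (hdecV τ hτ y) (norm_nonneg _)
      _ = D * (‖y‖ / (‖y‖ + Real.sqrt (-(τ - 1 / 4)))) := by ring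
      _ ≤ D * 1 := by
          refine mul_le_mul_of_nonneg_left ((div_le_one hden).2 (by linarith)) hD.le
      _ = D := mul_one D
  -- (ii) Oseen-mildness between every pair `s < t < 0`: KNSS Thm 6.1 (bounded weak form) on the window
  -- shifted to `(0, 1 − s)`
  have hmild : ∀ s t : ℝ, s < t → t < 0 → ∀ y : EuclideanSpace ℝ (Fin 3),
      V t y = UnboundedOperators.heatExtension (V s) (t - s) y - oseenDuhamel 1 s V V t y := by
    intro s t hst ht0 y
    set a : ℝ := s - 1 with ha_def
    set W : ℝ → EuclideanSpace ℝ (Fin 3) → EuclideanSpace ℝ (Fin 3) := fun σ => V (σ + a) with hW_def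
    have hWc : ContinuousOn (uncurry W) (Ioo 0 (-a) ×ˢ univ) := by
      have : uncurry W = uncurry V ∘ fun z : ℝ × EuclideanSpace ℝ (Fin 3) => (z.1 + a, z.2) := by
        funext z; rfl
      rw [this]
      exact (hVc.comp ((continuous_fst.add continuous_const).prodMk continuous_snd)).continuousOn
    have hWbw : IsBoundedWeakNSSolutionOn (Ioo 0 (-a)) isOpen_Ioo 1 W :=
      (hbw.mono (J := Ioo a 0) isOpen_Ioo Ioo_subset_Iio_self).comp_add_right a (J := Ioo 0 (-a))
        isOpen_Ioo fun τ => by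
          simp only [mem_Ioo]
          constructor <;> intro h <;> constructor <;> linarith [h.1, h.2]
    have hWL : ∀ σ ∈ Ioo 0 (-a), ∀ x, ‖W σ x‖ ≤ 2 * D := fun σ hσ x => hL (σ + a) (by linarith [hσ.2]) x
    have hWD : ∀ σ ∈ Ioo 0 (-a), ∀ x : EuclideanSpace ℝ (Fin 3), cylRadius (x - 0) * ‖W σ x‖ ≤ D :=
      fun σ hσ x => hDec (σ + a) (by linarith [hσ.2]) x
    have hm := oseenMild_of_cylRadius_decay_window_of_boundedWeak KNSS2009_weak_driftMild_holds hWc hWbw hWL hWD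
      (s - a) (t - a) (by rw [ha_def]; linarith) (by linarith) (by linarith) y
    have e1 : W (t - a) = V t := by simp [hW_def]
    have e2 : W (s - a) = V s := by simp [hW_def]
    have e3 : oseenDuhamel 1 (s - a) W W (t - a) y = oseenDuhamel 1 s V V t y := by
      have := oseenDuhamel_translate 1 (s - a) a V V (t - a) y
      rw [sub_add_cancel, sub_add_cancel] at this
      exact this
    rw [e1, e2, e3, show t - a - (s - a) = t - s by ring] at hm
    exact hm
  -- (iii) joint analyticity, hence smoothness, on the open slab
  have hbdd : ∀ δ : ℝ, 0 < δ → ∃ B : ℝ, ∀ t < -δ, ∀ y : EuclideanSpace ℝ (Fin 3), ‖V t y‖ ≤ B :=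
    fun δ hδ => ⟨2 * D, fun t ht y => hL t (by linarith) y⟩
  have han : AnalyticOnNhd ℝ (uncurry V) (Iio (0 : ℝ) ×ˢ univ) :=
    LocalSineTubeDoorProfileAlignedWindowRigidityAncient.analyticOnNhd_uncurry hcont hbdd hmild
  have hsm : IsSmoothSpaceTimeOn (Iio 0) V := han.contDiffOn (isOpen_Iio.prod isOpen_univ).uniqueDiffOn
  -- (iv)–(v) pressures on the windows `(−(k+1), 0)` and ONE pressure on `(−∞, 0)`
  have hwin : ∀ k : ℕ, ∃ q : ℝ → EuclideanSpace ℝ (Fin 3) → ℝ,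
      IsClassicalNSSolutionOn (Ioo (-((k : ℝ) + 1)) 0) 1 0 V q := fun k =>
    exists_pressure_window hsm hbw _
  choose q hq using hwin
  -- every `t < 0` lies in the window `(−(⌈−t⌉₊+1), 0)`
  have hcov : ∀ t ∈ Iio (0 : ℝ), ∃ k : ℕ, t ∈ Ioo (-((k : ℝ) + 1)) 0 := by
    intro t ht
    refine ⟨⌈-t⌉₊, ?_, ht⟩
    have h1 : -t ≤ (⌈-t⌉₊ : ℝ) := Nat.le_ceil _
    linarith
  obtain ⟨P, hP⟩ := rssCompact_exists_pressure_of_cover 1 0 V (Iio 0) (fun k => Ioo (-((k : ℝ) + 1)) 0) q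
    isOpen_Iio (fun _ => isOpen_Ioo) hcov hq
  -- translate back: `v t = V (t + 1/4)` on `(−∞, −1/4)`
  refine ⟨fun t => P (t + 1 / 4), ?_⟩
  have h1 := hP.comp_add_right (1 / 4)
  have hS : (fun t : ℝ => t + 1 / 4) ⁻¹' Iio 0 = Iio (-(1 / 4 : ℝ)) := by
    ext t; simp only [mem_preimage, mem_Iio]; constructor <;> intro h <;> linarith
  rw [hS] at h1
  refine h1.congr_velocity fun t _ => ?_
  simp only [hV, add_sub_cancel_right]

end Summit.NavierStokesRegularity.NavierStokesRegularity.Theorems.ZoomReturnDoorClassicalLimit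

end
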